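import Summits.QuantumFields.YangMills.Theorems.TransportPerturbationWeakHarrisOneStep
import Summits.QuantumFields.YangMills.Theorems.TransportPerturbationWindowSemigroup
import HarnessLib

/-!
# Route `TransportPerturbation`, LINE 10 «harris_hybrid» (crux K1 `LyapunovContraction`, stmt-QuantumFields-26986): the two
# registered stubs whose route items are CLOSED, BY NAME — `stub_weakHarrisOneStep`, `stub_windowSemigroup`

Registry hygiene (seat `ym-line-csu-p1`, g12).  In the skeleton `harris_hybrid_v3.lean` the stubs `stub_weakHarrisOneStep` and
`stub_windowSemigroup` are the aliases `__Registered.stub_weakHarrisOneStep := Theses.TransportPerturbation.WeakHarrisOneStep` (route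
item 27870, CLOSED by `TransportPerturbation.weakHarrisOneStep_proof`) and `__Registered.stub_windowSemigroup :=
Theses.TransportPerturbation.WindowSemigroup` (route item 27874, CLOSED by `TransportPerturbation.windowSemigroup_proof`).  This file
states the two aliases verbatim in the skeleton's namespace and discharges them by the landed route theorems, so that the crux's
stub registry shows them landed.  Nothing new is proved: the open content of LINE 10 is `stub_multiscaleDrift`,
`stub_closePairContraction`, `stub_regularPairOverlap` (all XL, HELD); K1 stays HELD; no summit is proved; the Yang–Mills mass gap is
NOT proved.
-/

set_option autoImplicit false

namespace Summit.QuantumFields.YangMills.Cruxes.LyapunovContraction.HarrisHybrid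

namespace __Registered
/-- registered stub alias (the landed route item). -/ abbrev stub_weakHarrisOneStep : Prop := Summit.QuantumFields.YangMills.Theses.TransportPerturbation.WeakHarrisOneStep
/-- registered stub alias (the landed route item). -/ abbrev stub_windowSemigroup : Prop := Summit.QuantumFields.YangMills.Theses.TransportPerturbation.WindowSemigroup
end __Registered

/-- STUB 1 of LINE 10 by name: the one-step weak Harris theorem (route item `WeakHarrisOneStep`, closed by
`TransportPerturbation.weakHarrisOneStep_proof`). [folklore] -/
theorem stub_weakHarrisOneStep : __Registered.stub_weakHarrisOneStep :=
  Summit.QuantumFields.YangMills.Theorems.TransportPerturbation.weakHarrisOneStep_proof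

/-- STUB 5 of LINE 10 by name: the window semigroup property (route item `WindowSemigroup`, closed by
`TransportPerturbation.windowSemigroup_proof`). [folklore] -/
theorem stub_windowSemigroup : __Registered.stub_windowSemigroup :=
  Summit.QuantumFields.YangMills.Theorems.TransportPerturbation.windowSemigroup_proof

end Summit.QuantumFields.YangMills.Cruxes.LyapunovContraction.HarrisHybrid
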